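import Summits.AtomisticToContinuum.Crystallization.Theorems.ReggeStarCoercivityDefectFreeCrystallizesExactFrameH01
import Summits.AtomisticToContinuum.Crystallization.Theorems.PalmUnimodularRigidityLayeredLawsSelectHcpChartStarFrame
import Literature.Geometry.DiscreteGeometry.KissingPatterns
import Literature.Probability.Process.PointStationaryLaw

/-!
# Exact stars at an h-type site give an exact frame, II (stub `stub_exactFrameH`, X2a of line `palm-good-law`,
# crux `ReggeStarCoercivity.DefectFreeCrystallizes`, stmt-AtomisticToContinuum-13603; part 2 of 2 — proves the
# registered stub)

Let `s` be a Hägg word, `X : ℤ³ → ℝ³` an injective CHART of a configuration against the ideal stacking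
`barlowStacking 1 √(2/3) s` (ideal contacts `dist = 1` ↔ pairs at distance in `(0, 6/5)`), and `u` an h-type
site (`s (u.1 − 1) ≠ s u.1`).  If the root star of the configuration re-rooted at `X u` is EXACT — congruence
defect `0` against the relaxed hcp star `hcpSite a₀ h₀` OR against the regular cuboctahedron
`a₀ • fccKissingPattern` — and the annulus `11/10 < ‖y‖ ≤ 5/4` is empty, then ONE linear isometry `A` carries
the relaxed struts `barlowPos a₀ h₀ s w − barlowPos a₀ h₀ s u` of the twelve contacts `w` of `u` onto `X w − X u`
(`stub_exactFrameH`).  With the labelled neighbour map `N` of part 1 (`dist_eq_one_iff_nbr`, `exists_twist`):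

* `rootStar_eq`: by the chart and the empty annulus the root star is the labelled twelve-point set
  `{X (N ε) − X u : ε ∈ hcpStarIdx}` (`count_restrict_singleton_ne_zero_iff`);
* `fcc_branch_false`: a vanishing defect against the cuboctahedron is attained (`exactCopy_of_iInf_eq_zero`);
  through the chart the induced labelling is a contact-graph embedding of the hcp star into the cuboctahedron
  (pattern distances are `1` or `≥ √2`, `fcc_dist_eq_one`), impossible by the TYPE GAP: the edge
  `{(0,1,0), (0,0,1)}` of the hcp star lies in two triangles (`ideal_edge_two_triangles`), every cuboctahedron
  edge in one (`fcc_edge_one_triangle`);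
* `hcp_branch_frame`: 9226's `exists_frame` verbatim with the window `6/5` — the exact copy with SOME labelling
  (`stub_localCongruenceExactStar`) induces a touching-preserving injective relabelling of `hcpStarIdx`, an
  isometry of the relaxed star (`stub_localCongruenceStarAut`), and the frame is read off three independent
  struts (`exists_linearIsometry_of_inner_eq`).

All `[folklore]`.
-/

noncomputable section

open scoped BigOperators
open MeasureTheory

namespace Summit.AtomisticToContinuum.Crystallization.Theorems.PalmGoodLaw.ExactFrameH

open Literature.MathematicalPhysics.StatisticalMechanics Literature.Geometry.DiscreteGeometry
open Literature.Probability.Process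
open Summit.AtomisticToContinuum.Crystallization.Theorems.PalmUnimodularRigidity.LayeredLawsSelectHcp
open scoped RealInnerProductSpace

section Chart

variable {a₀ h₀ : ℝ} {s : ℤ → ℤ} {X : ℤ × ℤ × ℤ → EuclideanSpace ℝ (Fin 3)} {u : ℤ × ℤ × ℤ}
  {N : ℤ × ℤ × ℤ → ℤ × ℤ × ℤ}

/-! ## The root star of the re-rooted configuration -/

/-- **The root star of the configuration re-rooted at `X u` is the labelled image of the twelve contacts of
`u`**: contacts are atoms at distance in `(0, 6/5)` (chart), the annulus `(11/10, 5/4]` is empty, and the atoms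
of `count|T` are the points of `T`. [folklore] -/
theorem rootStar_eq (hs : IsHaggSeq s) (hu : s (u.1 - 1) ≠ s u.1)
    (hN : ∀ ε, N ε = (u.1 + ε.1, u.2.1 + s u.1 * ε.2.1, u.2.2 + s u.1 * ε.2.2))
    (hchart : ∀ u w : ℤ × ℤ × ℤ, dist (barlowPos 1 (Real.sqrt (2 / 3)) s u.1 u.2.1 u.2.2)
      (barlowPos 1 (Real.sqrt (2 / 3)) s w.1 w.2.1 w.2.2) = 1 ↔ (0 < dist (X u) (X w) ∧ dist (X u) (X w) < 6 / 5))
    (hann : (Measure.count : Measure (EuclideanSpace ℝ (Fin 3))).restrict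
      ((fun z : EuclideanSpace ℝ (Fin 3) => z - X u) '' Set.range X)
      {y : EuclideanSpace ℝ (Fin 3) | 11 / 10 < ‖y‖ ∧ ‖y‖ ≤ 5 / 4} = 0) :
    rootStar ((Measure.count : Measure (EuclideanSpace ℝ (Fin 3))).restrict
        ((fun z : EuclideanSpace ℝ (Fin 3) => z - X u) '' Set.range X)) =
      ↑(hcpStarIdx.image fun ε => X (N ε) - X u) := by
  -- no atom in the annulus
  have hgap : ∀ w, ¬ (11 / 10 < ‖X w - X u‖ ∧ ‖X w - X u‖ ≤ 5 / 4) := by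
    intro w hw
    have hle := Measure.le_restrict_apply (μ := (Measure.count : Measure (EuclideanSpace ℝ (Fin 3))))
      ((fun z : EuclideanSpace ℝ (Fin 3) => z - X u) '' Set.range X)
      {y : EuclideanSpace ℝ (Fin 3) | 11 / 10 < ‖y‖ ∧ ‖y‖ ≤ 5 / 4}
    rw [hann, nonpos_iff_eq_zero, Measure.count_eq_zero_iff, Set.eq_empty_iff_forall_notMem] at hle
    exact hle (X w - X u) ⟨hw, X w, ⟨w, rfl⟩, rfl⟩
  ext y
  simp only [rootStar, Set.mem_setOf_eq, count_restrict_singleton_ne_zero_iff, Set.mem_image,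
    Set.mem_range, exists_exists_eq_and, Finset.coe_image, Finset.mem_coe]
  constructor
  · rintro ⟨⟨w, rfl⟩, hpos, hle⟩
    have hd : 0 < dist (X u) (X w) ∧ dist (X u) (X w) < 6 / 5 := by
      rw [dist_comm, dist_eq_norm]; exact ⟨hpos, by linarith⟩
    obtain ⟨ε, hε, rfl⟩ := (dist_eq_one_iff_nbr hs hu hN w).1 ((hchart u w).2 hd)
    exact ⟨ε, hε, rfl⟩
  · rintro ⟨ε, hε, rfl⟩
    have h1 := (dist_eq_one_iff_nbr hs hu hN (N ε)).2 ⟨ε, hε, rfl⟩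
    obtain ⟨hpos, hlt⟩ := (hchart u _).1 h1
    rw [dist_comm, dist_eq_norm] at hpos hlt
    refine ⟨⟨_, rfl⟩, hpos, ?_⟩
    by_contra hgt
    exact hgap _ ⟨not_le.1 hgt, by linarith⟩

/-! ## The fcc branch is impossible at an h-type site -/

/-- **No exact fcc star at an h-type site.** If the congruence defect of the labelled twelve-point star
`{X (N ε) − X u}` against the cuboctahedron `a₀ • fccKissingPattern` vanished, an exact copy
(`exactCopy_of_iInf_eq_zero`) would label the star by the pattern; through the chart (contacts `a₀ < 6/5`,
non-contacts `≥ a₀ √2 > 6/5`) ideal hcp-star contacts would become cuboctahedron edges, injectively — but the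
edge `{(0,1,0), (0,0,1)}` of the hcp star lies in two triangles and every cuboctahedron edge in one. [folklore] -/
theorem fcc_branch_false (ha₁ : 189 / 200 ≤ a₀) (hs : IsHaggSeq s) (hX : Function.Injective X)
    (hN : ∀ ε, N ε = (u.1 + ε.1, u.2.1 + s u.1 * ε.2.1, u.2.2 + s u.1 * ε.2.2))
    (hchart : ∀ u w : ℤ × ℤ × ℤ, dist (barlowPos 1 (Real.sqrt (2 / 3)) s u.1 u.2.1 u.2.2)
      (barlowPos 1 (Real.sqrt (2 / 3)) s w.1 w.2.1 w.2.2) = 1 ↔ (0 < dist (X u) (X w) ∧ dist (X u) (X w) < 6 / 5))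
    (hu : s (u.1 - 1) ≠ s u.1)
    (hfcc : (⨅ A : EuclideanSpace ℝ (Fin 3) ≃ₗᵢ[ℝ] EuclideanSpace ℝ (Fin 3), ∑ p ∈ fccKissingPattern,
      Metric.infDist (A (a₀ • p)) ↑(hcpStarIdx.image fun ε => X (N ε) - X u) ^ 2) = 0) :
    False := by
  set ZF : Finset (EuclideanSpace ℝ (Fin 3)) := hcpStarIdx.image fun ε => X (N ε) - X u with hZF
  have hZne : ZF.Nonempty := Finset.image_nonempty.2 ⟨(0, 1, 0), by decide⟩
  obtain ⟨g, hgZ, -, hgd⟩ := exactCopy_of_iInf_eq_zero fccKissingPattern (fun p => a₀ • p) ZF hZne hfcc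
  obtain ⟨T, hT⟩ := exists_twist hs hu hN
  have ha0 : 0 < a₀ := by linarith
  have hgd' : ∀ p ∈ fccKissingPattern, ∀ q ∈ fccKissingPattern, dist (g p) (g q) = a₀ * dist p q := by
    intro p hp q hq
    rw [hgd p hp q hq, dist_smul₀, Real.norm_of_nonneg ha0.le]
  have hginj : Set.InjOn g ↑fccKissingPattern := by
    intro p hp q hq hpq
    by_contra hne
    have h1 := one_le_dist_of_mem_fccKissingPattern hp hq hne
    have h0 : dist (g p) (g q) = 0 := by rw [hpq, dist_self]
    rw [hgd' p hp q hq] at h0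
    nlinarith
  have hcardZ : ZF.card ≤ fccKissingPattern.card := by
    rw [card_fccKissingPattern]
    exact Finset.card_image_le.trans (by rw [card_hcpStarIdx])
  have hsurj : Set.SurjOn g ↑fccKissingPattern ↑ZF :=
    Finset.surjOn_of_injOn_of_card_le g (fun p hp => hgZ p hp) hginj hcardZ
  -- the induced labelling of the star by pattern points
  have hlab : ∀ ε ∈ hcpStarIdx, ∃ p ∈ fccKissingPattern, g p = X (N ε) - X u := by
    intro ε hε
    have hmem : X (N ε) - X u ∈ (↑ZF : Set (EuclideanSpace ℝ (Fin 3))) := by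
      rw [hZF, Finset.coe_image]; exact ⟨ε, hε, rfl⟩
    obtain ⟨p, hp, hpe⟩ := hsurj hmem
    exact ⟨p, hp, hpe⟩
  choose! φ hφP hφeq using hlab
  have hφinj : Set.InjOn φ ↑hcpStarIdx := by
    intro ε hε ε' hε' h
    have h2 : X (N ε) - X u = X (N ε') - X u := by rw [← hφeq ε hε, ← hφeq ε' hε', h]
    exact nbr_injective hs hN (hX (sub_left_inj.1 h2))
  -- ideal star contacts go to cuboctahedron edges
  have hadj : ∀ ε ∈ hcpStarIdx, ∀ ε' ∈ hcpStarIdx,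
      dist (hcpSite 1 (Real.sqrt (2 / 3)) ε) (hcpSite 1 (Real.sqrt (2 / 3)) ε') = 1 → dist (φ ε) (φ ε') = 1 := by
    intro ε hε ε' hε' h1
    have hεε' : ε ≠ ε' := by rintro rfl; simp at h1
    obtain ⟨-, hlt⟩ := (hchart (N ε) (N ε')).1 (by
      rw [← dist_sub_right _ _ (barlowPos 1 (Real.sqrt (2 / 3)) s u.1 u.2.1 u.2.2), hT _ _ ε hε, hT _ _ ε' hε',
        LinearIsometryEquiv.dist_map]
      exact h1)
    rw [← dist_sub_right _ _ (X u), ← hφeq ε hε, ← hφeq ε' hε', hgd' _ (hφP ε hε) _ (hφP ε' hε')] at hlt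
    have hne : φ ε ≠ φ ε' := fun h => hεε' (hφinj hε hε' h)
    refine fcc_dist_eq_one _ (hφP ε hε) _ (hφP ε' hε') hne ?_
    have h127 : dist (φ ε) (φ ε') < 127 / 100 := by
      by_contra hge
      rw [not_lt] at hge
      have : a₀ * (127 / 100) ≤ a₀ * dist (φ ε) (φ ε') := mul_le_mul_of_nonneg_left hge ha0.le
      linarith
    exact h127.trans (by rw [Real.lt_sqrt (by norm_num)]; norm_num)
  -- the type gap
  obtain ⟨d01, d02, d12, d03, d13⟩ := ideal_edge_two_triangles
  have m0 : ((0, 1, 0) : ℤ × ℤ × ℤ) ∈ hcpStarIdx := by decide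
  have m1 : ((0, 0, 1) : ℤ × ℤ × ℤ) ∈ hcpStarIdx := by decide
  have m2 : ((1, 0, 0) : ℤ × ℤ × ℤ) ∈ hcpStarIdx := by decide
  have m3 : ((-1, 0, 0) : ℤ × ℤ × ℤ) ∈ hcpStarIdx := by decide
  have heq : φ (1, 0, 0) = φ (-1, 0, 0) :=
    fcc_edge_one_triangle (hφP _ m0) (hφP _ m1) (hφP _ m2) (hφP _ m3) (hadj _ m0 _ m1 d01)
      (hadj _ m0 _ m2 d02) (hadj _ m1 _ m2 d12) (hadj _ m0 _ m3 d03) (hadj _ m1 _ m3 d13)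
  exact absurd (hφinj m2 m3 heq) (by decide)

/-! ## The hcp branch: the labelled exact star and its frame -/

/-- **Labelled exact star at an h-type site** (port of 9226's `exists_frame`).  If the congruence defect of
the labelled star `{X (N ε) − X u}` against the relaxed hcp star `hcpSite a₀ h₀` vanishes, a linear isometry
`A` carries the relaxed struts of `u` onto it LABEL BY LABEL:
`X (N ε) − X u = A (barlowPos a₀ h₀ s (N ε) − barlowPos a₀ h₀ s u)`.  The exact copy with SOME labelling
(`stub_localCongruenceExactStar`) induces a relabelling of `hcpStarIdx` which is injective and, through the
chart (relaxed contacts `≤ 1 < 6/5 <` relaxed non-contacts), touching-preserving, hence an isometry of the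
relaxed star (`stub_localCongruenceStarAut`); `A` is read off three independent struts of the twisted
(`exists_twist`) relaxed star. [folklore] -/
theorem hcp_branch_frame (ha₁ : 189 / 200 ≤ a₀) (ha₂ : a₀ ≤ 199 / 200) (hh₁ : 77 / 100 ≤ h₀)
    (hh₂ : h₀ ≤ 163 / 200) (hs : IsHaggSeq s)
    (hN : ∀ ε, N ε = (u.1 + ε.1, u.2.1 + s u.1 * ε.2.1, u.2.2 + s u.1 * ε.2.2))
    (hchart : ∀ u w : ℤ × ℤ × ℤ, dist (barlowPos 1 (Real.sqrt (2 / 3)) s u.1 u.2.1 u.2.2)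
      (barlowPos 1 (Real.sqrt (2 / 3)) s w.1 w.2.1 w.2.2) = 1 ↔ (0 < dist (X u) (X w) ∧ dist (X u) (X w) < 6 / 5))
    (hu : s (u.1 - 1) ≠ s u.1)
    (hdef : (⨅ A : EuclideanSpace ℝ (Fin 3) ≃ₗᵢ[ℝ] EuclideanSpace ℝ (Fin 3), ∑ v ∈ hcpStarIdx,
      Metric.infDist (A (hcpSite a₀ h₀ v)) ↑(hcpStarIdx.image fun ε => X (N ε) - X u) ^ 2) = 0) :
    ∃ A : EuclideanSpace ℝ (Fin 3) ≃ₗᵢ[ℝ] EuclideanSpace ℝ (Fin 3), ∀ ε ∈ hcpStarIdx,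
      X (N ε) - X u = A (barlowPos a₀ h₀ s (N ε).1 (N ε).2.1 (N ε).2.2 - barlowPos a₀ h₀ s u.1 u.2.1 u.2.2) := by
  have ha0 : a₀ ≠ 0 := by intro h; rw [h] at ha₁; norm_num at ha₁
  have hh0 : h₀ ≠ 0 := by intro h; rw [h] at hh₁; norm_num at hh₁
  obtain ⟨T, hT⟩ := exists_twist hs hu hN
  suffices H : ∃ A : EuclideanSpace ℝ (Fin 3) ≃ₗᵢ[ℝ] EuclideanSpace ℝ (Fin 3), ∀ ε ∈ hcpStarIdx,
      X (N ε) - X u = A (T (hcpSite a₀ h₀ ε)) by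
    obtain ⟨A, hA⟩ := H
    exact ⟨A, fun ε hε => by rw [hT a₀ h₀ ε hε]; exact hA ε hε⟩
  set ZF : Finset (EuclideanSpace ℝ (Fin 3)) := hcpStarIdx.image fun ε => X (N ε) - X u with hZF
  set R : ℤ × ℤ × ℤ → EuclideanSpace ℝ (Fin 3) := hcpSite a₀ h₀ with hR
  have hZne : ZF.Nonempty := Finset.image_nonempty.2 ⟨(0, 1, 0), by decide⟩
  obtain ⟨g, hgZ, hgn, hgd⟩ := stub_localCongruenceExactStar a₀ h₀ ZF hZne hdef
  -- the induced relabelling `π`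
  have hlab : ∀ δ ∈ hcpStarIdx, ∃ ε ∈ hcpStarIdx, X (N ε) - X u = g δ := fun δ hδ => by
    have := hgZ δ hδ
    rw [hZF, Finset.mem_image] at this
    exact this
  choose! π hπmem hπeq using hlab
  have hgne : ∀ δ ∈ hcpStarIdx, ∀ δ' ∈ hcpStarIdx, δ ≠ δ' → 0 < dist (g δ) (g δ') := by
    intro δ hδ δ' hδ' hne
    rw [hgd δ hδ δ' hδ']
    by_cases h1 : dist (hcpSite 1 (Real.sqrt (2 / 3)) δ) (hcpSite 1 (Real.sqrt (2 / 3)) δ') = 1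
    · exact (star_dist_le_one ha₁ ha₂ hh₁ hh₂ hδ hδ' h1).1
    · linarith [star_dist_gt_six_fifths ha₁ hh₁ hδ hδ' hne h1]
  have hinj : Set.InjOn π ↑hcpStarIdx := by
    intro δ hδ δ' hδ' heq
    by_contra hne
    have := hgne δ hδ δ' hδ' hne
    rw [← hπeq δ hδ, ← hπeq δ' hδ', heq, dist_self] at this
    exact lt_irrefl _ this
  have hmaps : Set.MapsTo π ↑hcpStarIdx ↑hcpStarIdx := fun δ hδ => hπmem δ hδ
  have hsurj : Set.SurjOn π ↑hcpStarIdx ↑hcpStarIdx :=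
    Finset.surjOn_of_injOn_of_card_le π hmaps hinj le_rfl
  -- `π` preserves touching
  have hadj : ∀ δ ∈ hcpStarIdx, ∀ δ' ∈ hcpStarIdx,
      (dist (hcpSite 1 (Real.sqrt (2 / 3)) (π δ)) (hcpSite 1 (Real.sqrt (2 / 3)) (π δ')) = 1 ↔
        dist (hcpSite 1 (Real.sqrt (2 / 3)) δ) (hcpSite 1 (Real.sqrt (2 / 3)) δ') = 1) := by
    intro δ hδ δ' hδ'
    by_cases hne : δ = δ'
    · subst hne; simp
    have e1 : dist (barlowPos 1 (Real.sqrt (2 / 3)) s (N (π δ)).1 (N (π δ)).2.1 (N (π δ)).2.2)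
        (barlowPos 1 (Real.sqrt (2 / 3)) s (N (π δ')).1 (N (π δ')).2.1 (N (π δ')).2.2) =
        dist (hcpSite 1 (Real.sqrt (2 / 3)) (π δ)) (hcpSite 1 (Real.sqrt (2 / 3)) (π δ')) := by
      rw [← dist_sub_right _ _ (barlowPos 1 (Real.sqrt (2 / 3)) s u.1 u.2.1 u.2.2), hT _ _ _ (hπmem δ hδ),
        hT _ _ _ (hπmem δ' hδ'), LinearIsometryEquiv.dist_map]
    have e3 : dist (X (N (π δ))) (X (N (π δ'))) = dist (R δ) (R δ') := by
      rw [← dist_sub_right _ _ (X u), hπeq δ hδ, hπeq δ' hδ', hgd δ hδ δ' hδ']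
    rw [← e1, hchart, e3]
    constructor
    · rintro ⟨-, hlt⟩
      by_contra h1
      linarith [star_dist_gt_six_fifths ha₁ hh₁ hδ hδ' hne h1]
    · intro h1
      obtain ⟨hpos, hle1⟩ := star_dist_le_one ha₁ ha₂ hh₁ hh₂ hδ hδ' h1
      exact ⟨hpos, by linarith⟩
  have haut := stub_localCongruenceStarAut a₀ h₀ π hinj hmaps hadj
  -- the naturally labelled star has the metric of the twisted reference star
  have hzd : ∀ ε ∈ hcpStarIdx, ∀ ε' ∈ hcpStarIdx,
      dist (X (N ε) - X u) (X (N ε') - X u) = dist (T (R ε)) (T (R ε')) := by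
    intro ε hε ε' hε'
    obtain ⟨δ, hδ, rfl⟩ := hsurj hε
    obtain ⟨δ', hδ', rfl⟩ := hsurj hε'
    rw [hπeq δ hδ, hπeq δ' hδ', hgd δ hδ δ' hδ', LinearIsometryEquiv.dist_map, (haut δ hδ δ' hδ').1]
  have hzn : ∀ ε ∈ hcpStarIdx, ‖X (N ε) - X u‖ = ‖T (R ε)‖ := by
    intro ε hε
    obtain ⟨δ, hδ, rfl⟩ := hsurj hε
    rw [hπeq δ hδ, hgn δ hδ, LinearIsometryEquiv.norm_map, (haut δ hδ δ hδ).2]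
  have hinner : ∀ ε ∈ hcpStarIdx, ∀ ε' ∈ hcpStarIdx,
      ⟪T (R ε), T (R ε')⟫ = ⟪X (N ε) - X u, X (N ε') - X u⟫ := fun ε hε ε' hε' =>
    inner_eq_of_norm_eq_of_dist_eq (hzn ε hε).symm (hzn ε' hε').symm (hzd ε hε ε' hε').symm
  -- a linear isometry from three independent struts
  have m0 : ((0, 1, 0) : ℤ × ℤ × ℤ) ∈ hcpStarIdx := by decide
  have m1 : ((0, 0, 1) : ℤ × ℤ × ℤ) ∈ hcpStarIdx := by decide
  have m2 : ((1, 0, 0) : ℤ × ℤ × ℤ) ∈ hcpStarIdx := by decide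
  set p : Fin 3 → EuclideanSpace ℝ (Fin 3) := ![T (R (0, 1, 0)), T (R (0, 0, 1)), T (R (1, 0, 0))] with hp
  set q : Fin 3 → EuclideanSpace ℝ (Fin 3) :=
    ![X (N (0, 1, 0)) - X u, X (N (0, 0, 1)) - X u, X (N (1, 0, 0)) - X u] with hq
  have hli : LinearIndependent ℝ p := by
    have h := (linearIndependent_three_struts ha0 hh0).map' T.toLinearEquiv.toLinearMap
      T.toLinearEquiv.ker
    have hfun : ⇑T.toLinearEquiv.toLinearMap ∘ ![R (0, 1, 0), R (0, 0, 1), R (1, 0, 0)] = p := by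
      funext i; fin_cases i <;> rfl
    rw [hfun] at h
    exact h
  have hpq : ∀ i j, ⟪p i, p j⟫ = ⟪q i, q j⟫ := by
    intro i j
    fin_cases i <;> fin_cases j <;>
      simp only [hp, hq, Fin.zero_eta, Fin.mk_one, Fin.reduceFinMk, Matrix.cons_val_zero,
        Matrix.cons_val_one, Matrix.cons_val] <;> exact hinner _ (by decide) _ (by decide)
  obtain ⟨A₀, hA₀⟩ := exists_linearIsometry_of_inner_eq hli hpq
  set A : EuclideanSpace ℝ (Fin 3) ≃ₗᵢ[ℝ] EuclideanSpace ℝ (Fin 3) := A₀.toLinearIsometryEquiv rfl with hA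
  have hAp : ∀ i, A (p i) = q i := fun i => by rw [hA, LinearIsometry.coe_toLinearIsometryEquiv]; exact hA₀ i
  have hlq : LinearIndependent ℝ q := by
    have h := hli.map' A.toLinearEquiv.toLinearMap A.toLinearEquiv.ker
    have hfun : ⇑A.toLinearEquiv.toLinearMap ∘ p = q := by
      funext i; exact hAp i
    rw [hfun] at h
    exact h
  refine ⟨A, fun ε hε => ?_⟩
  symm
  rw [← sub_eq_zero]
  refine eq_zero_of_inner_linearIndependent_fin_three hlq fun i => ?_
  rw [inner_sub_left, sub_eq_zero, ← hAp i, A.inner_map_map, hAp i]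
  fin_cases i
  · simpa [hp, hq] using hinner ε hε _ m0
  · simpa [hp, hq] using hinner ε hε _ m1
  · simpa [hp, hq] using hinner ε hε _ m2

end Chart

/-! ## The registered stub -/

/-- **Stub `stub_exactFrameH` (X2a of line `palm-good-law`): exact stars at an h-type site give an exact
frame.**  For a Hägg word `s`, an injective chart `X : ℤ³ → ℝ³` against the ideal stacking (ideal contacts ↔
pairs at distance in `(0, 6/5)`), and an h-type site `u` (`s (u.1 − 1) ≠ s u.1`) whose re-rooted root star is
exact (defect `0` against the relaxed hcp star OR against `a₀ • fccKissingPattern`) with empty annulus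
`(11/10, 5/4]`, one linear isometry `A` gives `X w − X u = A (barlowPos a₀ h₀ s w − barlowPos a₀ h₀ s u)` for
all contacts `w` of `u`.  The root star is the labelled image of the twelve contacts (`rootStar_eq`); the fcc
branch is impossible (`fcc_branch_false`, type gap); in the hcp branch `hcp_branch_frame` gives `A` on the
relaxed struts of the labelled contacts, which are all the contacts (`dist_eq_one_iff_nbr`). [folklore] -/
theorem stub_exactFrameH :
    ∀ a₀ h₀ : ℝ, 189 / 200 ≤ a₀ → a₀ ≤ 199 / 200 → 77 / 100 ≤ h₀ → h₀ ≤ 163 / 200 →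
      ∀ s : ℤ → ℤ, IsHaggSeq s →
      ∀ X : ℤ × ℤ × ℤ → EuclideanSpace ℝ (Fin 3), Function.Injective X →
        (∀ u w : ℤ × ℤ × ℤ,
          dist (barlowPos 1 (Real.sqrt (2 / 3)) s u.1 u.2.1 u.2.2) (barlowPos 1 (Real.sqrt (2 / 3)) s w.1 w.2.1 w.2.2) = 1 ↔
            (0 < dist (X u) (X w) ∧ dist (X u) (X w) < 6 / 5)) →
        ∀ u : ℤ × ℤ × ℤ, s (u.1 - 1) ≠ s u.1 →
          (Summit.AtomisticToContinuum.Crystallization.Theorems.PalmUnimodularRigidity.LayeredLawsSelectHcp.starDefect a₀ h₀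
              ((Measure.count : Measure (EuclideanSpace ℝ (Fin 3))).restrict
                ((fun z : EuclideanSpace ℝ (Fin 3) => z - X u) '' Set.range X)) = 0 ∨
            (⨅ A : EuclideanSpace ℝ (Fin 3) ≃ₗᵢ[ℝ] EuclideanSpace ℝ (Fin 3),
              ∑ p ∈ fccKissingPattern, Metric.infDist (A (a₀ • p))
                (Summit.AtomisticToContinuum.Crystallization.Theorems.PalmUnimodularRigidity.LayeredLawsSelectHcp.rootStar
                  ((Measure.count : Measure (EuclideanSpace ℝ (Fin 3))).restrict
                    ((fun z : EuclideanSpace ℝ (Fin 3) => z - X u) '' Set.range X))) ^ 2) = 0) →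
          (Measure.count : Measure (EuclideanSpace ℝ (Fin 3))).restrict
              ((fun z : EuclideanSpace ℝ (Fin 3) => z - X u) '' Set.range X)
              {y : EuclideanSpace ℝ (Fin 3) | 11 / 10 < ‖y‖ ∧ ‖y‖ ≤ 5 / 4} = 0 →
          ∃ A : EuclideanSpace ℝ (Fin 3) ≃ₗᵢ[ℝ] EuclideanSpace ℝ (Fin 3), ∀ w : ℤ × ℤ × ℤ,
            dist (barlowPos 1 (Real.sqrt (2 / 3)) s u.1 u.2.1 u.2.2) (barlowPos 1 (Real.sqrt (2 / 3)) s w.1 w.2.1 w.2.2) = 1 →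
            X w - X u = A (barlowPos a₀ h₀ s w.1 w.2.1 w.2.2 - barlowPos a₀ h₀ s u.1 u.2.1 u.2.2) := by
  intro a₀ h₀ ha₁ ha₂ hh₁ hh₂ s hs X hX hchart u hu hstar hann
  have hN : ∀ ε : ℤ × ℤ × ℤ,
      (fun ε : ℤ × ℤ × ℤ => (u.1 + ε.1, u.2.1 + s u.1 * ε.2.1, u.2.2 + s u.1 * ε.2.2)) ε =
        (u.1 + ε.1, u.2.1 + s u.1 * ε.2.1, u.2.2 + s u.1 * ε.2.2) := fun _ => rfl
  have hZ := rootStar_eq hs hu hN hchart hann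
  rcases hstar with hhcp | hfcc
  · rw [starDefect, hZ] at hhcp
    obtain ⟨A, hA⟩ := hcp_branch_frame ha₁ ha₂ hh₁ hh₂ hs hN hchart hu hhcp
    refine ⟨A, fun w hw => ?_⟩
    obtain ⟨ε, hε, rfl⟩ := (dist_eq_one_iff_nbr hs hu hN w).1 hw
    exact hA ε hε
  · rw [hZ] at hfcc
    exact (fcc_branch_false ha₁ hs hX hN hchart hu hfcc).elim

end Summit.AtomisticToContinuum.Crystallization.Theorems.PalmGoodLaw.ExactFrameH

end
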